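import Summits.AnomalousDissipation.AnomalousDissipation.Theses.EnsembleRigidity
import Summits.AnomalousDissipation.AnomalousDissipation.Theorems.EnsembleRigidityGPStatisticalRigidityPartial
import Summits.AnomalousDissipation.AnomalousDissipation.Theorems.EnsembleRigidityGPStatisticalRigidityWeakDuality2
import Summits.AnomalousDissipation.AnomalousDissipation.Theorems.EnsembleRigidityGPStatisticalRigidityLinearHorizon
import Summits.AnomalousDissipation.AnomalousDissipation.Theorems.TameClosure.Negative.EscapingAtom
import Summits.AnomalousDissipation.AnomalousDissipation.Theorems.EnsembleRigidityGPTameDefectFloorWeakDuality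
import Summits.AnomalousDissipation.AnomalousDissipation.Theorems.EnsembleRigidityGPTameDefectFloorLinearFloor
import Summits.AnomalousDissipation.AnomalousDissipation.Theorems.EnsembleRigidityGPTameDefectFloorParityForm
import Summits.AnomalousDissipation.AnomalousDissipation.Theorems.EnsembleRigidityGPTameDefectFloorEnergyIdle
import Summits.AnomalousDissipation.AnomalousDissipation.Theorems.EnsembleRigidityGPTameDefectFloorRegionTools
import Summits.AnomalousDissipation.AnomalousDissipation.Theorems.EnsembleRigidityGPTameDefectFloorParityForm2
import Summits.AnomalousDissipation.AnomalousDissipation.Theorems.EnsembleRigidityGPTameDefectFloorRegionTools2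
import Summits.AnomalousDissipation.AnomalousDissipation.Theorems.EnsembleRigidityGPTameDefectFloorParityForm3
import Summits.AnomalousDissipation.AnomalousDissipation.Theorems.EnsembleRigidityGPTameDefectFloorRegionTools3
import Summits.AnomalousDissipation.AnomalousDissipation.Theorems.EnsembleRigidityGPMeanBoundedFamilyStubHeadModes
import HarnessLib

/-!
# Crux `EnsembleRigidity.GPTameDefectFloor` (stmt-AnomalousDissipation-17938), line `Sketch` —
# SKELETON: linear layer (energy / enstrophy certificates by a fixed test field) + weak duality for
# cylindrical certificates above the linear layer

T = TAME DEFECT FLOOR OF `f_GP`: for every energy level `E` and mean-enstrophy level `G₁` there is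
`r = r(E, G₁) > 0` such that no probability measure `μ` on `H = L²_σ(T³)` with `∫|v|² dμ ≤ E`,
`∫‖∇v‖² dμ ≤ G₁` has Φ-uniform cylindrical forced-Euler defect `≤ r`.

COMPOSITION (`GPTameDefectFloor_of`, sorry-free given the stubs):

* `E < 3/(4π)` (any `G₁`) or `G₁ < 3√2·π` (any `E`): the LINEAR LAYER. A fixed smooth solenoidal
  mean-zero test field `w` with the FORM BOUND `∫ (v ⊗ v) : ∇w ≥ −s_E |v|² − s_G ‖∇v‖²` on
  finite-enstrophy fields certifies the floor at every level with `s_E E + s_G max(G₁,0) < (f_GP, w)`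
  (`stub_linearFloor`: cut-off removal `stub_linearTestLimit` + integration; the card's L1 with an
  energy term). The field `w = f_GP` is an energy certificate with `s_E = 2π` (landed pointwise strain
  bound, horizon `E < 3/(4π)`) and an ENSTROPHY certificate with `s_G = √2/(4π)` by the parity of
  `|k|²` (`stub_gpParityForm`, the card's L1′; horizon `G₁ < (3/2)·(4π/√2) = 3√2·π ≈ 13.33`, against
  the tree's `3π ≈ 9.42`).
* `G₁ ≥ 3√2·π`: the OPEN CONTENT. A cylindrical certificate of the registered Farkas-dual shape at the
  normalised level `(G₁/(4π²), G₁)` (`stub_tameCertificatesHigh`, reshaped: one parameter, the energy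
  being idle by the sharp Poincaré inequality) is integrated by the registered weak duality
  (`stub_tameWeakDuality`, provable now: `weakDuality2_integrate` + arithmetic), and the floor is
  transported to every energy level by `stub_energyIdle` (`4π² ∫|v|² ≤ ∫‖∇v‖²`).

Stubs: `stub_tameWeakDuality`, `stub_linearFloor`, `stub_gpParityForm`, `stub_energyIdle`, `stub_gpTameRegionTools`,
`stub_gpParityForm2` (+Tools), `stub_gpTameRegionTools2`, `stub_gpParityForm3` (+ToolsA/B), `stub_gpTameRegionTools3` —
ALL LANDED (cycle 1); `stub_tameCertificatesHigh` (G₁ ≥ 150/7) — OPEN (the crux's content above the linear layer; linear certificates provably stop at a finite level `G_lin ≈ 31`,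
termwise proofs for `w ∝ f_GP` stop at `24.27`; beyond, the certificate must be genuinely cylindrical/nonlinear).
-/

-- `Summit.<Summit>.<Problem>` is the tree's mandated summit-side namespace (CONVENTIONS §2); single-conjunct summit, duplicate deliberate.
set_option linter.dupNamespace false

noncomputable section

namespace Summit.AnomalousDissipation.AnomalousDissipation.Theorems.EnsembleRigidity.GPTameDefectFloor

open MeasureTheory Filter Topology UnitAddTorus
open scoped InnerProductSpace RealInnerProductSpace ENNReal NNReal
open Literature.Analysis.FunctionSpaces Literature.Analysis.FluidPDE
open Summit.AnomalousDissipation.AnomalousDissipation.Theorems.EnsembleRigidity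

/-- Local notation: real vector fields on `T³`. -/
local notation "Vec3" => (UnitAddTorus (Fin 3)) → (EuclideanSpace ℝ (Fin 3))
/-- Local notation: `L²(T³; ℝ³)`. -/
local notation "L2" => (Lp (EuclideanSpace ℝ (Fin 3)) 2 (volume : Measure (UnitAddTorus (Fin 3))))
/-- Local notation: the energy space `H`. -/
local notation "H3" => (Torus.energySpace (Fin 3))

/-! ## Stub 1 (registered at birth): weak duality for one cylindrical certificate -/

-- `stub_tameWeakDuality`: LANDED, Theorems/EnsembleRigidityGPTameDefectFloorWeakDuality.lean (p158866) — imported above.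

/-! ## Stub 2: the linear floor (a fixed test field with an energy/enstrophy form bound) -/

-- `stub_linearFloor`: LANDED, Theorems/EnsembleRigidityGPTameDefectFloorLinearFloor.lean (p159165) — imported above.

/-! ## Stub 3: the parity enstrophy certificate `w = f_GP` -/

-- `stub_gpParityForm`: LANDED, Theorems/EnsembleRigidityGPTameDefectFloorParityForm.lean (p160223) — imported above.

/-! ## Stub 4: the energy level is idle (sharp Poincaré) -/

-- `stub_energyIdle`: LANDED, Theorems/EnsembleRigidityGPTameDefectFloorEnergyIdle.lean (p159721) — imported above.

/-! ## Stub 5 (cycle 1, wave 2): the refined enstrophy form bound — exact shell-1/2 block -/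

-- `stub_gpParityForm2`: LANDED, Theorems/EnsembleRigidityGPTameDefectFloorParityForm2.lean (p163994; tools p163706) — imported above.

/-! ## Tools stub (cycle 1, wave 2): the proved region `G₁ < 18` and the reduction -/

-- `stub_gpTameRegionTools2`: LANDED (proposal p165191), Theorems/EnsembleRigidityGPTameDefectFloorRegionTools2.lean — imported above.

/-! ## Stub 7 (cycle 1, wave 3): the potential-table enstrophy form bound `c₀ = 7/100` -/

-- `stub_gpParityForm3`: LANDED, Theorems/EnsembleRigidityGPTameDefectFloorParityForm3.lean (p170057; tools p168426, p168421) — imported above.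

/-! ## Tools stub (cycle 1, wave 3): the proved region `G₁ < 150/7` and the reduction -/

-- `stub_gpTameRegionTools3`: LANDED (proposal p170380), Theorems/EnsembleRigidityGPTameDefectFloorRegionTools3.lean — imported above.

/-! ## Stub A (cycle 2, lead c1): the termwise-optimal enstrophy certificate `c₀ = 1/15` of the landed analytic layer -/

/-- **Stub `stub_gpTermwiseForm15`** (enstrophy axis). For every `v ∈ H` with finite enstrophy,
`∫ (v ⊗ v) : ∇f_GP ≥ -(1/15) ‖∇v‖²`: the landed analytic layer `form3_pairing_ge_enstrophy`
(…ParityForm3ToolsB) fed with the OPTIMAL general slot weights of that layer (its optimum is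
`c₀* = 0.066268…`, computed exactly: the slot graph of `f_GP` is a disjoint union of paths, on which
weighted AM–GM is lossless; explicit rational table of 114 non-unit weights on the box `[-3,3]³`,
slack `0.57 %`). Certifies the tame defect floor for all `G₁ < (3/2)·15 = 45/2`. [folklore] -/
theorem stub_gpTermwiseForm15 : ∀ v : H3, Torus.eGradNormSq ((v : L2) : Vec3) ≠ ⊤ → -(1 / 15 * (Torus.eGradNormSq ((v : L2) : Vec3)).toReal) ≤ Torus.inertialPairing (v : L2) gpForce := by
  sorry

/-! ## Stub B (cycle 2, lead c1): the pointwise strain bound of the two-shell energy certificate -/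

/-- **Stub `stub_gpEnergyPointwise`** (energy axis, the polynomial heart). For the two-shell field
`w = f_GP + (7/20)·g`, `g = (f_GP·∇)f_GP/(2π) = lambMode`, the symmetric gradient at the point
`(X, Y, Z) = 2π·x` has zero diagonal and off-diagonal entries `π·a, π·b, π·c` with
`a = cos X + (7/20)(cos Y cos Z − sin X sin Z)`, `b = cos Z + (7/20)(cos X cos Y − sin Y sin Z)`,
`c = cos Y + (7/20)(cos X cos Z − sin X sin Y)`; its least eigenvalue over `T³` is
`−2π(t + 1/(8t)) = −(99/70)π` at `t = 7/20` (attained on the line `(s, π−s, −s)`, `cos s = 5/7`), and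
`(143/100)·I + (a,b,c)-matrix ⪰ 0` everywhere (margin `0.0157`). Stated as the nonnegativity of the
quadratic form; proved by an exact rational SOS/DSOS certificate. [folklore] -/
theorem stub_gpEnergyPointwise : ∀ X Y Z v₀ v₁ v₂ : ℝ, 0 ≤ 143 / 100 * (v₀ ^ 2 + v₁ ^ 2 + v₂ ^ 2) +
      2 * ((Real.cos X + 7 / 20 * (Real.cos Y * Real.cos Z - Real.sin X * Real.sin Z)) * (v₀ * v₁) +
        (Real.cos Z + 7 / 20 * (Real.cos X * Real.cos Y - Real.sin Y * Real.sin Z)) * (v₀ * v₂) +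
        (Real.cos Y + 7 / 20 * (Real.cos X * Real.cos Z - Real.sin X * Real.sin Y)) * (v₁ * v₂)) := by
  sorry

/-! ## Stub C (cycle 2, lead c1): the two-shell energy certificate field -/

/-- **Stub `stub_gpEnergyField`** (energy axis, the field). Given the pointwise bound of
`stub_gpEnergyPointwise`, the explicit two-shell field `w = f_GP + (7/20)·lambMode` is smooth,
solenoidal and mean-free, has `(f_GP, w) = 3/2` (the Lamb mode lives on the shell `|k|² = 2`,
orthogonal to `f_GP`), and satisfies the ENERGY form bound `∫ (v ⊗ v) : ∇w ≥ −(143/100)π ‖v‖²` on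
`H` (pointwise `⟪∇w(x) u, u⟫ = 2π(a u₀u₁ + b u₀u₂ + c u₁u₂) ≥ −(143/100)π |u|²`, integrated as in
`gpForce_inertialPairing_ge`). With `stub_linearFloor` (`s_E = 143π/100 < 9/2`, `s_G = 0`) this
certifies the tame defect floor at EVERY energy level `E ≤ 1/3` and EVERY `G₁` — the judge's
"one energy level in [0.3, 1] at every G₁" (tree before: `E < 3/(4π) ≈ 0.239`; the two-shell
optimum is `3/(2√2 π) ≈ 0.3376`, shells 3–4 add nothing, shell 5 reaches `0.358`). [folklore] -/
theorem stub_gpEnergyField : (∀ X Y Z v₀ v₁ v₂ : ℝ, 0 ≤ 143 / 100 * (v₀ ^ 2 + v₁ ^ 2 + v₂ ^ 2) +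
      2 * ((Real.cos X + 7 / 20 * (Real.cos Y * Real.cos Z - Real.sin X * Real.sin Z)) * (v₀ * v₁) +
        (Real.cos Z + 7 / 20 * (Real.cos X * Real.cos Y - Real.sin Y * Real.sin Z)) * (v₀ * v₂) +
        (Real.cos Y + 7 / 20 * (Real.cos X * Real.cos Z - Real.sin X * Real.sin Y)) * (v₁ * v₂))) → Torus.IsSmooth (gpForce + (7 / 20 : ℝ) • lambMode) ∧ Torus.IsDivFree (gpForce + (7 / 20 : ℝ) • lambMode) ∧ Torus.HasZeroMean (gpForce + (7 / 20 : ℝ) • lambMode) ∧ (∫ x, ⟪gpForce x, (gpForce + (7 / 20 : ℝ) • lambMode) x⟫_ℝ) = 3 / 2 ∧ (∀ v : H3, -(143 / 100 * Real.pi * ‖v‖ ^ 2) ≤ Torus.inertialPairing (v : L2) (gpForce + (7 / 20 : ℝ) • lambMode)) := by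
  sorry

/-! ## Stub 6 (open content): cylindrical certificates above the linear layer `G₁ ≥ 45/2` -/

/-- **Stub `stub_tameCertificatesHigh`** (OPEN — the crux's content above the termwise-optimal
linear enstrophy horizon; one parameter `G₁ ≥ 45/2`, level normalised to `E₀ = G₁/(4π²)` by the
idle energy). For every `G₁ ≥ 45/2` the Galloway–Proctor force admits a cylindrical test functional
`Ψ` and constants `a`, `b ≥ 0`, `C > 0`, `Λ > 0` with `Λ⁻¹(1 + max G₁ 0) < a − b G₁/(4π²)`, cost
`‖∇Ψ'(v)‖² ≤ C²(1 + ‖∇v‖²)` and the pointwise forced-Euler Lyapunov inequality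
`a − b|v|² − Λ⁻¹(1 + ‖∇v‖²) ≤ ⟨f_GP − B(v,v), Ψ'(v)⟩` at every finite-enstrophy `v ∈ H`. Ladder of
what is provable with LINEAR `Ψ`: tables of the landed layer stop at `22.6`, any termwise scheme at
`24.3`, the sharp `w ∝ f_GP` constant gives `25.7`, optimised linear fields `≈ 31`; beyond, the
certificate must be genuinely nonlinear, and for `G₁ → ∞` no construction is known (⇔ crux N,
`GPEulerCoercive`, kernel-checked `T ↔ N`). -/
theorem stub_tameCertificatesHigh : ∀ f : Vec3, f = (fun x : UnitAddTorus (Fin 3) => (Literature.Analysis.FluidPDE.Torus.stokesMode (Pi.single (2 : Fin 3) (1 : ℤ)) (EuclideanSpace.single (0 : Fin 3) (1 : ℝ)) false x + Literature.Analysis.FluidPDE.Torus.stokesMode (Pi.single (0 : Fin 3) (1 : ℤ)) (EuclideanSpace.single (1 : Fin 3) (1 : ℝ)) false x + Literature.Analysis.FluidPDE.Torus.stokesMode (Pi.single (1 : Fin 3) (1 : ℤ)) (EuclideanSpace.single (2 : Fin 3) (1 : ℝ)) false x : EuclideanSpace ℝ (Fin 3))) → ∀ G₁ : ℝ, (45 /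 2 : ℝ) ≤ G₁ → ∃ (Ψ : Torus.CylindricalTest (Fin 3)) (a b C Λ : ℝ), 0 ≤ b ∧ 0 < C ∧ 0 < Λ ∧ Λ⁻¹ * (1 + max G₁ 0) < a - b * (G₁ / (4 * Real.pi ^ 2)) ∧ (∀ v : H3, Torus.gradNormSq (Ψ.grad v) ≤ C ^ 2 * (1 + (Torus.eGradNormSq ((v : L2) : Vec3)).toReal)) ∧ (∀ v : H3, Torus.eGradNormSq ((v : L2) : Vec3) ≠ ⊤ → a - b * ‖v‖ ^ 2 - Λ⁻¹ * (1 + (Torus.eGradNormSq ((v : L2) : Vec3)).toReal) ≤ Torus.nsGeneratorPairing 0 f v (Ψ.grad v)) := by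
  sorry

/-! ## Tools stub (cycle 2): the proved regions `G₁ < 45/2` (any `E`), `E ≤ 1/3` (any `G₁`) and the reduction -/

/-- **Tools stub `stub_gpTameRegionTools4`** (lead c1): (i) T at every level with `G₁ < 45/2`
(`stub_linearFloor` + `stub_gpTermwiseForm15`); (ii) T at every level with `E ≤ 1/3`
(`stub_linearFloor` + `stub_gpEnergyField ∘ stub_gpEnergyPointwise`, `143π/300 < 3/2` from
`π < 3.1416`); (iii) the reduction: certificates above `45/2` (`stub_tameCertificatesHigh`) ⇒ the crux
(`stub_tameWeakDuality` + `stub_energyIdle`). [folklore] -/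
theorem stub_gpTameRegionTools4 : (∀ f : Vec3, f = gpForce → ∀ E G₁ : ℝ, G₁ < 45 / 2 → ∃ r : ℝ, 0 < r ∧ ∀ μ : Measure H3, IsProbabilityMeasure μ → Integrable (fun v : H3 => ‖v‖ ^ 2) μ → Torus.ensembleEnergy μ ≤ E → Torus.ensembleEnstrophy μ ≤ ENNReal.ofReal G₁ → ¬ (∀ Φ : Torus.CylindricalTest (Fin 3), Integrable (fun v : H3 => Torus.nsGeneratorPairing 0 f v (Φ.grad v)) μ ∧ |∫ v, Torus.nsGeneratorPairing 0 f v (Φ.grad v) ∂μ| ≤ r * Real.sqrt (∫ v, Torus.gradNormSq (Φ.grad v) ∂μ))) ∧ (∀ f : Vec3, f = gpForce → ∀ E G₁ : ℝ, E ≤ 1 / 3 → ∃ r : ℝ, 0 < r ∧ ∀ μ : Measure H3, IsProbabilityMeasure μ → Integrable (fun v : H3 => ‖v‖ ^ 2) μ → Torus.ensembleEnergy μ ≤ E → Torus.ensembleEnstrophy μ ≤ ENNReal.ofReal G₁ → ¬ (∀ Φ : Torus.CylindricalTest (Fin 3), Integrable (fun v : H3 => Torus.nsGeneratorPairing 0 f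 v (Φ.grad v)) μ ∧ |∫ v, Torus.nsGeneratorPairing 0 f v (Φ.grad v) ∂μ| ≤ r * Real.sqrt (∫ v, Torus.gradNormSq (Φ.grad v) ∂μ))) ∧ ((∀ f : Vec3, f = (fun x : UnitAddTorus (Fin 3) => (Literature.Analysis.FluidPDE.Torus.stokesMode (Pi.single (2 : Fin 3) (1 : ℤ)) (EuclideanSpace.single (0 : Fin 3) (1 : ℝ)) false x + Literature.Analysis.FluidPDE.Torus.stokesMode (Pi.single (0 : Fin 3) (1 : ℤ)) (EuclideanSpace.single (1 : Fin 3) (1 : ℝ)) false x + Literature.Analysis.FluidPDE.Torus.stokesMode (Pi.single (1 : Fin 3) (1 : ℤ)) (EuclideanSpace.single (2 : Fin 3) (1 : ℝ)) false x : EuclideanSpace ℝ (Fin 3))) → ∀ G₁ : ℝ, (45 / 2 : ℝ) ≤ G₁ → ∃ (Ψ : Torus.CylindricalTest (Fin 3)) (a b C Λ : ℝ), 0 ≤ b ∧ 0 < C ∧ 0 < Λ ∧ Λ⁻¹ * (1 + max G₁ 0) < a - b * (G₁ / (4 * Real.pi ^ 2)) ∧ (∀ v : H3, Torus.gradNormSq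 (Ψ.grad v) ≤ C ^ 2 * (1 + (Torus.eGradNormSq ((v : L2) : Vec3)).toReal)) ∧ (∀ v : H3, Torus.eGradNormSq ((v : L2) : Vec3) ≠ ⊤ → a - b * ‖v‖ ^ 2 - Λ⁻¹ * (1 + (Torus.eGradNormSq ((v : L2) : Vec3)).toReal) ≤ Torus.nsGeneratorPairing 0 f v (Ψ.grad v))) → Summit.AnomalousDissipation.AnomalousDissipation.Theses.EnsembleRigidity.GPTameDefectFloor) := by
  sorry

/-! ## The composition -/

/-- **Line `Sketch` closes the crux modulo its stubs** (skeleton v9, lead c1):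
`EnsembleRigidity.GPTameDefectFloor` from the open stub `stub_tameCertificatesHigh` (`G₁ ≥ 45/2`)
through the reduction `stub_gpTameRegionTools4` (levels `G₁ < 45/2`: the linear layer with the
termwise-optimal table `stub_gpTermwiseForm15`; levels `G₁ ≥ 45/2`: certificate + weak duality +
idle energy; the energy region `E ≤ 1/3` of `stub_gpEnergyField` is recorded alongside). -/
theorem GPTameDefectFloor_of :
    Summit.AnomalousDissipation.AnomalousDissipation.Theses.EnsembleRigidity.GPTameDefectFloor :=
  stub_gpTameRegionTools4.2.2 stub_tameCertificatesHigh

end Summit.AnomalousDissipation.AnomalousDissipation.Theorems.EnsembleRigidity.GPTameDefectFloor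

end
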